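import Mathlib.Data.List.Sort
import Summits.Ventures.QEC.Census.CNFEncodeXor
import HarnessLib

/-!
# Parity (GF(2) Farkas) certificates for fibre instances (CDX, qec-cdx-eng-1 g2)

A fibre instance `SolvesAny n rows [u] w` asks for an assignment with every row of `rows` EVEN and `u` ODD (and weight `≤ w`).
If some sub-multiset of rows together with `u` covers every coordinate an even number of times, the parities cannot all hold:
XOR-ing them gives `odd = even`.  `parityCert rows u idx` checks exactly that for the rows with indices `idx` (kernel-cheap:
concatenate, insertion-sort, check adjacent equal pairs), and `not_solvesAny_of_parityCert` is its soundness — a certificate of a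
few dozen row indices then replaces an LRAT replay for the instances whose GF(2) relaxation is already infeasible (about half of the
order-#345 budget-0 leaves).  Pure list/parity reasoning; nothing about a code.  No `native_decide`.
-/

namespace Summit.Ventures.QEC.CircuitDistance

open Summit.Ventures.QEC.Census.CNFEncode

/-- `lparity` is invariant under permutations of the list. -/
theorem lparity_perm {a : ℕ → Bool} {l₁ l₂ : List ℕ} (h : l₁.Perm l₂) : lparity a l₁ = lparity a l₂ := by
  induction h with
  | nil => rfl
  | cons x _ ih => simp [lparity, ih]
  | swap x y l =>
    simp only [lparity]
    cases a x <;> cases a y <;> simp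
  | trans _ _ ih₁ ih₂ => exact ih₁.trans ih₂

/-- The list consists of adjacent equal pairs. -/
def pairedUp : List ℕ → Bool
  | [] => true
  | [_] => false
  | x :: y :: t => (x == y) && pairedUp t

/-- A paired-up list has even parity under every assignment. -/
theorem lparity_of_pairedUp (a : ℕ → Bool) : ∀ l : List ℕ, pairedUp l = true → lparity a l = false
  | [], _ => rfl
  | [_], h => by simp [pairedUp] at h
  | x :: y :: t, h => by
    simp only [pairedUp, Bool.and_eq_true, beq_iff_eq] at h
    obtain ⟨rfl, ht⟩ := h
    have := lparity_of_pairedUp a t ht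
    simp only [lparity, this]
    cases a x <;> rfl

/-- Concatenation of the rows with the listed indices (out-of-range indices contribute nothing). -/
def selRows (rows : List (List ℕ)) : List ℕ → List ℕ
  | [] => []
  | i :: is => rows.getD i [] ++ selRows rows is

/-- Selected rows of an all-even row system have even parity. -/
theorem lparity_selRows (a : ℕ → Bool) (rows : List (List ℕ)) (hrows : ∀ r ∈ rows, lparity a r = false) :
    ∀ idx : List ℕ, lparity a (selRows rows idx) = false
  | [] => rfl
  | i :: is => by
    simp only [selRows, lparity_append, lparity_selRows a rows hrows is, Bool.xor_false]
    by_cases hi : i < rows.length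
    · rw [List.getD_eq_getElem _ _ hi]; exact hrows _ (List.getElem_mem hi)
    · rw [List.getD_eq_default _ _ (Nat.le_of_not_lt hi)]; rfl

/-- PARITY CERTIFICATE CHECK: `u` together with the rows indexed by `idx` covers every coordinate an even number of times
(tested by insertion-sorting the concatenation and pairing up adjacent entries). -/
def parityCert (rows : List (List ℕ)) (u : List ℕ) (idx : List ℕ) : Bool :=
  pairedUp ((u ++ selRows rows idx).insertionSort (· ≤ ·))

/-- **Soundness of parity certificates**: a passing certificate refutes the fibre instance (for every weight bound). -/
theorem not_solvesAny_of_parityCert {n : ℕ} {rows : List (List ℕ)} {u : List ℕ} {w : ℕ} (idx : List ℕ)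
    (h : parityCert rows u idx = true) : ¬ ∃ a, SolvesAny n rows [u] w a := by
  rintro ⟨a, hrows, ⟨u', hu', hodd⟩, -⟩
  rw [List.mem_singleton] at hu'
  subst hu'
  have h1 : lparity a (u' ++ selRows rows idx) = true := by
    rw [lparity_append, hodd, lparity_selRows a rows hrows idx]; rfl
  have h2 : lparity a (u' ++ selRows rows idx) = false := by
    rw [lparity_perm (List.perm_insertionSort (· ≤ ·) (u' ++ selRows rows idx)).symm]
    exact lparity_of_pairedUp a _ h
  rw [h1] at h2
  exact Bool.noConfusion h2

end Summit.Ventures.QEC.CircuitDistance
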